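import Literature.Algebra.Homology.DiscreteRepExtOneLayerDescentInflation
import Literature.NumberTheory.GaloisCohomology.RestrictedRamificationExtTrivComparison
import Literature.NumberTheory.GaloisRepresentations.GaloisCohomologyInflationColimit
import Literature.NumberTheory.GaloisCohomology.PoitouTateRestrictedRamification
import Literature.GroupTheory.ProfiniteSubquotients
import HarnessLib

/-!
# The bridge `nat_S : H¹(G_S, M^{N_S}) ≅ Ext¹_{C_{G_S}}(ℤ, M^{N_S})` in LAYER currency, its naturality, and its
# compatibility with inflation to `Γ_K` (door-c5's `OpenLayer.extOneEquiv`)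

Topic `NumberTheory/GaloisCohomology`; namespace `Literature.NumberTheory.GaloisCohomology.RestrictedExtLayer`.
One definition WITH BODY (`natLayerS`) and theorems; no named fact, no instance, no notation, no `sorry`.
Lane «PT-Ш-S-TC» of cell `bsd-eis` (crux `GoodLatticeBDPValue`, stmt-BirchSwinnertonDyer-19032), brick D4b / F2d
step (d) (`F2D-SCOPING-w6g11.md` §2 (d): "`nat_S` vs `nat` under inflation").

THE POINT.  The `Ext` road to `poitouTate_shaRestricted_tateDual_natural_at K S` (-w2 g11,
`PoitouTateRestrictedShaExtRoad`, kit `PoitouTateRestrictedShaNaturalAtOfExtRoadKit`) reads the global pairing as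
`read x y = inv_S (nat_S y ∘ x)` for a bridge `nat_S : H¹(G_S, A) → Ext¹_{C_{G_S}}(ℤ, A)`, and its reciprocity
input (R4)_S compares that value with local Tate pairings of the COCYCLE classes `loc_v (inf y)`.  Every
reciprocity law the tree proves (door-c5's all-places `hR4_ideleProjection`, door-c4 g18) evaluates the bridge
on LAYER classes through door-c5's `OpenLayer.extOneEquiv ρ = LayerColimit.desc (layer inflations)` at `Γ_K`;
the compatibility of the tree's ABSTRACT comparison `DiscreteRep.extTrivAddEquivContinuousCohomology` (the
kit's `natS`) with `inflG` is not in the tree.  This file supplies the bridge at `G_S` in the same layer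
currency and its transport to `Γ_K`:

* **`natLayerS S ρ := (ExtOneLayer.extOneEquivH1 (ρ.quotientInvariants N_S))⁻¹ :
  restrictedCohomology ρ S 1 →+ Ext¹_{C_{G_S}}(ℤ, ⟨M^{N_S}⟩)`** (generic layer descent of
  `DiscreteRepExtOneLayerDescent` at the profinite group `G_S = Γ_K ⧸ N_S`), `natLayerS_bijective`,
  `natLayerS_layerInf` (value on an inflated layer class: `nat_S (inf_Ū [γ]) = inflG Ū [γ]`);
* **`natLayerS_symm_naturality`** — VERBATIM the shape of the kit's `hnatG`
  (`RestrictedExtTriv.extTrivAddEquivRestrictedCohomology_symm_naturality` with `natLayerS` for `Φ⁻¹`):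
  `nat_S' (H¹(G_S, F) c) = (nat_S c) ∘ quotientInvariantsMap F`;
* **`extOneToGaloisCohomology_eq_extOneToH1`** — door-c5's `OpenLayer.extOneToGaloisCohomology ρ` IS the generic
  layer descent `ExtOneLayer.extOneToH1 ρ` at `Γ_K` (both are `LayerColimit.desc` of the layer inflations);
* (d) **`extOneEquiv_symm_restrictedInf`**: for `y ∈ H¹(G_S, M^{N_S})`,
  `(OpenLayer.extOneEquiv ρ)⁻¹ (restrictedInf y) = Inf_{N_S} (nat_S y) ≫ incl` — door-c5's bridge at `Γ_K` of the
  inflated class is the `Ext`-inflation (`DiscreteRep.inflExtHomTriv N_S`, -w6 g11; source object spelled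
  `ofContinuousRep (ρ.quotientInvariants N_S)` = the kit's `A`) of the `G_S`-bridge followed by the counit
  `invariantsInclQuot N_S : Inf(M^{N_S}) ⟶ M`; layerwise this is -w6 g11's inflation in stages.

HONEST FRAMING: bookkeeping over the cited files; no arithmetic statement, no case of Poitou–Tate duality and nothing
about BSD is proved here.  AI formalisation, weaker than expert review; established only by the kernel check.

## References
* J.-P. Serre, *Galois Cohomology* (1997), I §2.2 Proposition 8 and Corollary 1, §2.6 (b). [SerreGaloisCohomology1997]
* D. Harari, *Galois Cohomology and Class Field Theory* (2020), §4.3 Remark 4.24, §17.2 (p. 290). [Harari2020]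
* J. S. Milne, *Arithmetic Duality Theorems*, 2nd ed. (2006), I §4, proof of Thm. 4.10 (p. 58). [MilneADT2006]
-/

noncomputable section

open CategoryTheory CategoryTheory.Abelian NumberField IsDedekindDomain Function groupCohomology
open scoped NumberField ContRepresentation

namespace Literature.NumberTheory.GaloisCohomology

namespace RestrictedExtLayer

open Literature.Algebra.Homology Literature.Algebra.Homology.DiscreteRep
open Literature.NumberTheory.GaloisRepresentations Literature.GroupTheory Field
open Literature.NumberTheory.GaloisRepresentations.DiscreteGaloisModule (restrictedCohomology restrictedInf)

variable {K : Type} [Field K] [NumberField K]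
  {M : Type} [AddCommGroup M] [TopologicalSpace M] [DiscreteTopology M]
  {M' : Type} [AddCommGroup M'] [TopologicalSpace M'] [DiscreteTopology M']
  (ρ : DiscreteGaloisModule K M) (ρ' : DiscreteGaloisModule K M') (S : Set (HeightOneSpectrum (𝓞 K)))

/-! ## §1 The bridge `nat_S` in layer currency -/

/-- **`nat_S : H¹(G_S, M^{N_S}) →+ Ext¹_{C_{G_S}}(ℤ, M^{N_S})`**, the INVERSE of the generic layer descent
`ExtOneLayer.extOneEquivH1` (Serre I §2.2 Prop. 8 in degree `1`) for the profinite group `G_S` and the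
`G_S`-module `M^{N_S} = ρ.quotientInvariants N_S`. [cite: Harari2020, §4.3 Remark 4.24 and §17.2]
[cite: SerreGaloisCohomology1997, I §2.2 Proposition 8] -/
def natLayerS : restrictedCohomology ρ S 1 →+
    Ext (triv (Γ := GaloisGroupUnramifiedOutside K S) ℤ)
      (ofContinuousRep (ρ.quotientInvariants (ramificationSubgroup K S))) 1 :=
  haveI := ProfiniteSubquotients.totallyDisconnectedSpace_quotient (ramificationSubgroup K S) (ramificationSubgroup_isClosed K S)
  (ExtOneLayer.extOneEquivH1 (ρ.quotientInvariants (ramificationSubgroup K S))).symm.toAddMonoidHom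

/-- `nat_S` is bijective. [cite: SerreGaloisCohomology1997, I §2.2 Proposition 8, §2.6 (b)] -/
theorem natLayerS_bijective : Bijective (natLayerS ρ S) :=
  haveI := ProfiniteSubquotients.totallyDisconnectedSpace_quotient (ramificationSubgroup K S) (ramificationSubgroup_isClosed K S)
  (ExtOneLayer.extOneEquivH1 (ρ.quotientInvariants (ramificationSubgroup K S))).symm.bijective

/-- `Φ (nat_S y) = y` for the layer descent `Φ = ExtOneLayer.extOneToH1`. [cite: SerreGaloisCohomology1997, I §2.2 Proposition 8] -/
theorem extOneToH1_natLayerS (y : restrictedCohomology ρ S 1) :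
    haveI := ProfiniteSubquotients.totallyDisconnectedSpace_quotient (ramificationSubgroup K S) (ramificationSubgroup_isClosed K S)
    ExtOneLayer.extOneToH1 (ρ.quotientInvariants (ramificationSubgroup K S)) (natLayerS ρ S y) = y :=
  haveI := ProfiniteSubquotients.totallyDisconnectedSpace_quotient (ramificationSubgroup K S) (ramificationSubgroup_isClosed K S)
  (ExtOneLayer.extOneEquivH1 (ρ.quotientInvariants (ramificationSubgroup K S))).apply_symm_apply y

/-- `nat_S (Φ x) = x`. [cite: SerreGaloisCohomology1997, I §2.2 Proposition 8] -/
theorem natLayerS_extOneToH1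
    (x : Ext (triv (Γ := GaloisGroupUnramifiedOutside K S) ℤ)
      (ofContinuousRep (ρ.quotientInvariants (ramificationSubgroup K S))) 1) :
    haveI := ProfiniteSubquotients.totallyDisconnectedSpace_quotient (ramificationSubgroup K S) (ramificationSubgroup_isClosed K S)
    natLayerS ρ S (ExtOneLayer.extOneToH1 (ρ.quotientInvariants (ramificationSubgroup K S)) x) = x :=
  haveI := ProfiniteSubquotients.totallyDisconnectedSpace_quotient (ramificationSubgroup K S) (ramificationSubgroup_isClosed K S)
  (ExtOneLayer.extOneEquivH1 (ρ.quotientInvariants (ramificationSubgroup K S))).symm_apply_apply x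

/-- **`nat_S` on an inflated layer class is the layer class**: `nat_S (inf_Ū c) = inflG Ū c` for
`c ∈ H¹(G_S ⧸ Ū, (M^{N_S})^Ū)`. [cite: SerreGaloisCohomology1997, I §2.2 Proposition 8] -/
theorem natLayerS_layerInf (Ū : OpenNormalSubgroup (GaloisGroupUnramifiedOutside K S))
    (c : groupCohomology ((invariantsQuotFunctor ℤ (Ū : Subgroup (GaloisGroupUnramifiedOutside K S))).obj
      (ofContinuousRep (ρ.quotientInvariants (ramificationSubgroup K S)))) 1) :
    natLayerS ρ S (ExtOneLayer.layerInf (ρ.quotientInvariants (ramificationSubgroup K S)) Ū c) =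
      LayerColimit.inflG Ū (ofContinuousRep (ρ.quotientInvariants (ramificationSubgroup K S))) 1 c := by
  haveI := ProfiniteSubquotients.totallyDisconnectedSpace_quotient (ramificationSubgroup K S) (ramificationSubgroup_isClosed K S)
  rw [← ExtOneLayer.extOneToH1_inflG]
  exact natLayerS_extOneToH1 ρ S _

/-- **`nat_S` on the class of an inflated layer cocycle**: `nat_S [σ ↦ γ(σ̄)] = inflG Ū [γ]`.
[cite: SerreGaloisCohomology1997, I §2.2 Proposition 8] -/
theorem natLayerS_oneCocycleClass_inflateCocycle (Ū : OpenNormalSubgroup (GaloisGroupUnramifiedOutside K S))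
    (γ : cocycles₁ ((invariantsQuotFunctor ℤ (Ū : Subgroup (GaloisGroupUnramifiedOutside K S))).obj
      (ofContinuousRep (ρ.quotientInvariants (ramificationSubgroup K S))))) :
    natLayerS ρ S (oneCocycleClass (ρ.quotientInvariants (ramificationSubgroup K S)).toTopRep
        (ExtOneLayer.inflateCocycle (ρ.quotientInvariants (ramificationSubgroup K S)) Ū γ)) =
      LayerColimit.inflG Ū (ofContinuousRep (ρ.quotientInvariants (ramificationSubgroup K S))) 1 (H1π _ γ) := by
  rw [← ExtOneLayer.layerInf_H1π]
  exact natLayerS_layerInf ρ S Ū _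

/-- **Naturality of `nat_S` in the module, in the shape of the kit's `hnatG`**:
`nat_{M'} (H¹(G_S, F) c) = (nat_M c) ∘ F` for a continuous `Γ_K`-map `F : M → M'` (the lane's
`RestrictedExtTriv.quotientInvariantsMap ρ ρ' S F` on the `Ext` side). [cite: Harari2020, §4.3 Remark 4.24] -/
theorem natLayerS_symm_naturality (F : ρ.toTopRep ⟶ ρ'.toTopRep) (c : restrictedCohomology ρ S 1) :
    natLayerS ρ' S
        ((ContinuousCohomology.map (ContinuousMonoidHom.id (GaloisGroupUnramifiedOutside K S))
          (ContinuousRep.invariantsHom (N := ramificationSubgroup K S) F) 1).hom c) =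
      (natLayerS ρ S c).comp (Ext.mk₀ (RestrictedExtTriv.quotientInvariantsMap ρ ρ' S F)) (add_zero 1) :=
  haveI := ProfiniteSubquotients.totallyDisconnectedSpace_quotient (ramificationSubgroup K S) (ramificationSubgroup_isClosed K S)
  ExtOneLayer.extOneEquivH1_symm_naturality (ρ.quotientInvariants (ramificationSubgroup K S))
    (ρ'.quotientInvariants (ramificationSubgroup K S)) (ContinuousRep.invariantsHom (N := ramificationSubgroup K S) F) c

/-! ## §2 Door-c5's bridge at `Γ_K` is the generic layer descent -/

/-- **`OpenLayer.extOneToGaloisCohomology ρ = ExtOneLayer.extOneToH1 ρ`**: door-c5's degree-`1` bridge at `Γ_K`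
and the generic layer descent agree (both are `LayerColimit.desc` of the layer inflations `[γ] ↦ [σ ↦ γ(σ̄)]`;
uniqueness of the descent). [cite: SerreGaloisCohomology1997, I §2.2 Proposition 8] -/
theorem extOneToGaloisCohomology_eq_extOneToH1 :
    OpenLayer.extOneToGaloisCohomology ρ = ExtOneLayer.extOneToH1 ρ := by
  refine ExtOneLayer.eq_extOneToH1_of_forall_inflG ρ _ fun U c => ?_
  induction c using H1_induction_on with
  | h γ =>
    have h1 := OpenLayer.extOneToGaloisCohomology_inflG_H1π ρ U γ
    have h2 := ExtOneLayer.layerInf_H1π ρ U γ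
    have h12 : oneCocycleClass ρ.toTopRep (OpenLayer.inflateOpenCocycle ρ U γ) =
        oneCocycleClass ρ.toTopRep (ExtOneLayer.inflateCocycle ρ U γ) :=
      congrArg _ (Subtype.ext (ContinuousMap.ext fun σ => rfl))
    exact h1.trans (h12.trans h2.symm)

/-- Pointwise form. [cite: SerreGaloisCohomology1997, I §2.2 Proposition 8] -/
theorem extOneToGaloisCohomology_apply (x : Ext (triv (Γ := absoluteGaloisGroup K) ℤ) (ofDiscreteGaloisModule ρ) 1) :
    OpenLayer.extOneToGaloisCohomology ρ x = ExtOneLayer.extOneToH1 ρ x :=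
  DFunLike.congr_fun (extOneToGaloisCohomology_eq_extOneToH1 ρ) x

/-- The same for the inverse equivalences: `(OpenLayer.extOneEquiv ρ)⁻¹ = (ExtOneLayer.extOneEquivH1 ρ)⁻¹`.
[cite: SerreGaloisCohomology1997, I §2.2 Proposition 8] -/
theorem extOneEquiv_symm_apply (y : galoisCohomology ρ 1) :
    (OpenLayer.extOneEquiv ρ).symm y = (ExtOneLayer.extOneEquivH1 ρ).symm y := by
  apply (OpenLayer.extOneEquiv ρ).injective
  rw [AddEquiv.apply_symm_apply, OpenLayer.extOneEquiv_apply, extOneToGaloisCohomology_apply,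
    ← ExtOneLayer.extOneEquivH1_apply, AddEquiv.apply_symm_apply]

/-! ## §3 (d): `nat_S` versus the bridge at `Γ_K` under inflation -/

omit [NumberField K] in
/-- The tree's `restrictedInf ρ S 1 : H¹(G_S, M^{N_S}) →+ H¹(K, M)` IS Mathlib's inflation `inflH1 N_S ρ` of the generic
file (same term). [cite: Harari2020, §17.2 (p. 290)] -/
theorem restrictedInf_eq_inflH1 (y : restrictedCohomology ρ S 1) :
    restrictedInf ρ S 1 y = (ExtOneLayer.inflH1 (ramificationSubgroup K S) ρ).hom y := rfl

/-- **(d), generic-descent currency**: `(ExtOneLayer.extOneEquivH1 ρ)⁻¹ (restrictedInf y) = Inf_{N_S} (nat_S y) ≫ incl`.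
[cite: SerreGaloisCohomology1997, I §2.2 Proposition 8][cite: Harari2020, §4.3 Remark 4.24] -/
theorem extOneEquivH1_symm_restrictedInf (y : restrictedCohomology ρ S 1) :
    (ExtOneLayer.extOneEquivH1 ρ).symm (restrictedInf ρ S 1 y) =
      (DiscreteRep.inflExtHomTriv (ramificationSubgroup K S)
          (ofContinuousRep (ρ.quotientInvariants (ramificationSubgroup K S))) 1 (natLayerS ρ S y)).comp
        (Ext.mk₀ (DiscreteRep.invariantsInclQuot (ramificationSubgroup K S) (ofDiscreteGaloisModule ρ))) (add_zero 1) :=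
  haveI := ProfiniteSubquotients.totallyDisconnectedSpace_quotient (ramificationSubgroup K S) (ramificationSubgroup_isClosed K S)
  ExtOneLayer.extOneEquivH1_symm_inflH1 (ramificationSubgroup K S) ρ y

/-- **(d), door-c5 currency**: `(OpenLayer.extOneEquiv ρ)⁻¹ (restrictedInf y) = Inf_{N_S} (nat_S y) ≫ incl` — the bridge
at `Γ_K` used by the tree's all-places reciprocity law (`hR4_ideleProjection`) evaluated on a class inflated from
`G_S` is the `Ext`-inflation of the `G_S`-bridge `nat_S`, pushed into `M` by the counit `Inf(M^{N_S}) ⟶ M`.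
[cite: SerreGaloisCohomology1997, I §2.2 Proposition 8][cite: Harari2020, §4.3 Remark 4.24]
[cite: MilneADT2006, I §4, proof of Thm. 4.10 (p. 58)] -/
theorem extOneEquiv_symm_restrictedInf (y : restrictedCohomology ρ S 1) :
    (OpenLayer.extOneEquiv ρ).symm (restrictedInf ρ S 1 y) =
      (DiscreteRep.inflExtHomTriv (ramificationSubgroup K S)
          (ofContinuousRep (ρ.quotientInvariants (ramificationSubgroup K S))) 1 (natLayerS ρ S y)).comp
        (Ext.mk₀ (DiscreteRep.invariantsInclQuot (ramificationSubgroup K S) (ofDiscreteGaloisModule ρ))) (add_zero 1) := by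
  rw [extOneEquiv_symm_apply, extOneEquivH1_symm_restrictedInf]

/-- **(d), forward form**: `Φ_{Γ_K} (Inf_{N_S} (nat_S y) ≫ incl) = restrictedInf y` for door-c5's
`Φ_{Γ_K} = OpenLayer.extOneToGaloisCohomology ρ`. [cite: SerreGaloisCohomology1997, I §2.2 Proposition 8]
[cite: Harari2020, §4.3 Remark 4.24] -/
theorem extOneToGaloisCohomology_inflExtHomTriv_natLayerS (y : restrictedCohomology ρ S 1) :
    OpenLayer.extOneToGaloisCohomology ρ
        ((DiscreteRep.inflExtHomTriv (ramificationSubgroup K S)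
            (ofContinuousRep (ρ.quotientInvariants (ramificationSubgroup K S))) 1 (natLayerS ρ S y)).comp
          (Ext.mk₀ (DiscreteRep.invariantsInclQuot (ramificationSubgroup K S) (ofDiscreteGaloisModule ρ))) (add_zero 1)) =
      restrictedInf ρ S 1 y := by
  rw [← extOneEquiv_symm_restrictedInf, ← OpenLayer.extOneEquiv_apply, AddEquiv.apply_symm_apply]

/-- **(d) on layer cocycles** (the form the reciprocity law consumes): for a layer cocycle
`γ ∈ Z¹(G_S ⧸ Ū, (M^{N_S})^Ū)`, the `Ext`-inflation of `inflG Ū [γ]` pushed into `M` is door-c4's layer class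
`inflG (π⁻¹Ū) M 1 [γ ∘ θ]` of `Γ_K`, and door-c5's bridge sends it to the inflated cocycle class `[σ ↦ γ(σ̄)]`.
[cite: SerreGaloisCohomology1997, I §2.2 Proposition 8] -/
theorem extOneToGaloisCohomology_inflExtHomTriv_inflG_H1π (Ū : OpenNormalSubgroup (GaloisGroupUnramifiedOutside K S))
    (γ : cocycles₁ ((invariantsQuotFunctor ℤ (Ū : Subgroup (GaloisGroupUnramifiedOutside K S))).obj
      ((invariantsQuotD ℤ (ramificationSubgroup K S)).obj (ofDiscreteGaloisModule ρ)))) :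
    OpenLayer.extOneToGaloisCohomology ρ
        ((DiscreteRep.inflExtHomTriv (ramificationSubgroup K S)
            ((invariantsQuotD ℤ (ramificationSubgroup K S)).obj (ofDiscreteGaloisModule ρ)) 1
            (LayerColimit.inflG Ū ((invariantsQuotD ℤ (ramificationSubgroup K S)).obj (ofDiscreteGaloisModule ρ)) 1
              (H1π _ γ))).comp
          (Ext.mk₀ (DiscreteRep.invariantsInclQuot (ramificationSubgroup K S) (ofDiscreteGaloisModule ρ))) (add_zero 1)) =
      restrictedInf ρ S 1
        (oneCocycleClass (ρ.quotientInvariants (ramificationSubgroup K S)).toTopRep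
          (ExtOneLayer.inflateCocycle (ρ.quotientInvariants (ramificationSubgroup K S)) Ū γ)) := by
  haveI := ProfiniteSubquotients.totallyDisconnectedSpace_quotient (ramificationSubgroup K S) (ramificationSubgroup_isClosed K S)
  rw [extOneToGaloisCohomology_apply, restrictedInf_eq_inflH1,
    ExtOneLayer.extOneToH1_inflExtHomTriv_comp_invariantsInclQuot_inflG_H1π,
    ExtOneLayer.extOneToH1_inflG_H1π]
  rfl

end RestrictedExtLayer

end Literature.NumberTheory.GaloisCohomology

end
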